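import Summits.QuantumFields.YangMills.Theorems.BalabanUVNodesPortS1Sect5EuclStepOn
import Literature.MathematicalPhysics.QuantumFieldTheory.Balaban1983to89.Node00.EuclCovTransportOfRecord

/-!
# NODE O port, row PT-A-2 S5-0 (ii) — FILE E4c: [Balaban1987RG1] p. 263 «We assume that the action (1.3) is invariant with respect to the transformations of
# the lattice T⁽ᵏ⁾ … we notice that the explicitly defined expressions in the j-th term … are invariant» — THE INDUCTION `A_0 → A_k` FOR THE LATTICE SYMMETRIES,
# ON THE DOMAINS: the Euclidean twin of N09 MODULE 5 `B12ContinuousTransportInvarianceOn` §1–§2 (`liftInvariant_integrand_of_invOn`,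
# `invOn_effActionHT_of_stepsOn`), over an ABSTRACT family of level maps `r j` (instantiated by `τ`, `π`, `c_ρ`), plus the dischargers of the per-step image row
# at the transport of record `T := TcanOfRecord` (FILE E3 `TcanOfRecord_{translate,permute,creflect}_of_mem_regSet`)

CITATION HEADER.  [I] = [Balaban1987RG1] p. 263, (0.17)–(0.19) p. 255, (0.13) p. 254, (2.17) p. 269.  Porter PT-A-2 (`ymgap-nodeO-port-PTA-2`), `--supports
stmt-QuantumFields-27930 --as helper`.  Companions: FILE E4b `…PortS1Sect5EuclStepOn` (the step functional ∕ merged term on the domains, which READS the `A_k`-row this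
file DELIVERS), FILE E3 `Node00/EuclCovTransportOfRecord`, FILE E2 `Node00/EuclCovAxOfRecord` (the (2.9) cut-off's invariance on the [B11] domain = the `hχ` row below at
`χ := chiβOfRecord₁₃Ax θ`), `B12GaugeFixInvariance269.gaugeFixFn_translate ∕ _creflect ∕ _permute_of_adm` (the `hGF` row at `gfOfRecord`).

WHAT IS PROVED.  §1 `integrand_comp_eq_of_invOn` — the (0.19) density `χ·exp[−GF∕g² + A]` is invariant under a level map `r` at EVERY point as soon as `χ`, `GF`, `A`
are invariant ON an `r`-stable set `D` off which `χ` vanishes.  §2 `invOn_effActionHT_of_stepsOn_family` — for level maps `r j` with `A^η ∘ r 0 = A^η` and the per-step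
image row «`A_j` invariant on `D j` ⇒ `T K j ρ_j` invariant under `r (j+1)` on `D (j+1)`», every `A_k`, `k ≤ n`, is `r k`-invariant on `D k`.  §3 at `T := TcanOfRecord`:
`image_row_Tcan_of_comp_eq` (generic pair) and `image_row_Tcan_{translate,permute,creflect}` — the image row from the pointwise invariance of `ρ_j` under the fine map,
integrability, and `D (j+1) ⊆ regSetOfRecord K j ρ_j` (N09's (F7a) shape).
HONEST FRAMING.  Bookkeeping; displayed rows are hypotheses; nothing of Bałaban's estimates asserted, ported or discharged; 27930⁸ signed-open; no `sorry`, standard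
axioms; finite 𝕋⁴ at fixed ε — NOT continuum∕OS∕Clay; the Yang–Mills mass gap is NOT proved by any of this.
-/

noncomputable section

namespace Summit.QuantumFields.YangMills.Theorems.BalabanUVNodesPortS1

open Literature.MathematicalPhysics.QuantumFieldTheory.Balaban1983to89
open Literature.MathematicalPhysics.QuantumFieldTheory.Balaban1983to89.Node00
open T4Continuum (T4Family)
open B12Eq019ActionBody (nextAction nextAction_apply integrand integrand_apply wilsonTerm wilsonTerm_apply)
open MeasureTheory

/-! ## §1. The (0.19) density is invariant at every point from on-domain invariance -/

/-- **`χ(rU)·exp[−GF(rU)∕g² + A(rU)] = χ(U)·exp[−GF(U)∕g² + A(U)]` FOR EVERY `U`** as soon as `D` is `r`-stable, `χ` vanishes off `D`, and `χ`, `GF`, `A` are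
`r`-invariant ON `D` (off `D` both sides vanish).  Euclidean twin of N09's `liftInvariant_integrand_of_invOn`. [cite: Balaban1987RG1, (0.19) p.255 and p.263] -/
theorem integrand_comp_eq_of_invOn {P : Params} {G : Type*} [GaugeGroup G] {j : ℕ} {χ GF A : Density P j G} {r : GaugeField P j G → GaugeField P j G}
    {D : Set (GaugeField P j G)} (hDst : ∀ U, r U ∈ D ↔ U ∈ D) (hχD : ∀ U, U ∉ D → χ U = 0) (hχ : ∀ U, U ∈ D → χ (r U) = χ U)
    (hGF : ∀ U, U ∈ D → GF (r U) = GF U) (hA : ∀ U, U ∈ D → A (r U) = A U) (gk : ℝ) (U : GaugeField P j G) :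
    integrand χ GF gk A (r U) = integrand χ GF gk A U := by
  rw [integrand_apply, integrand_apply]
  by_cases hU : U ∈ D
  · rw [hχ U hU, hGF U hU, hA U hU]
  · rw [hχD U hU, hχD (r U) (fun h => hU ((hDst U).1 h)), zero_mul, zero_mul]

/-! ## §2. The induction `A_0 → A_k` over an abstract family of level maps -/

variable (F : T4Family) (N : ℕ) [NeZero N]

/-- **THE EFFECTIVE ACTIONS ARE INVARIANT ON THE DOMAINS under a family of level maps `r j`** (p. 263): `A_0 = −(1∕g₀²)A^η` is invariant wherever the Wilson action is
(`h0`), and the per-step image row carries invariance of `A_j` on `D j` to invariance of `A_{j+1} = log 𝐍_j⁻¹ (T K j ρ_j)(·)` on `D (j+1)`.  Euclidean twin of N09's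
`invOn_effActionHT_of_stepsOn`, abstract in the maps. [cite: Balaban1987RG1, p.263, (0.17)–(0.19) p.255] -/
theorem invOn_effActionHT_of_stepsOn_family (T : Transport F N) (χ : (K : ℕ) → (ℕ → ℝ) → (k : ℕ) → Density (F.P K) k (SU N)) (K : ℕ) (g : ℕ → ℝ)
    (n : ℕ) (D : (j : ℕ) → Set (GaugeField (F.P K) j (SU N))) (r : (j : ℕ) → GaugeField (F.P K) j (SU N) → GaugeField (F.P K) j (SU N))
    (h0 : ∀ U : GaugeField (F.P K) 0 (SU N), wilsonAction 1 (r 0 U) = wilsonAction 1 U)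
    (hstep : ∀ j < n, (∀ U, U ∈ D j → effActionHT F N T χ K g j (r j U) = effActionHT F N T χ K g j U) →
      ∀ V, V ∈ D (j + 1) →
        T K j (integrand (χ K g j) (gfOfRecord F N K j) (g j) (effActionHT F N T χ K g j)) (r (j + 1) V) =
          T K j (integrand (χ K g j) (gfOfRecord F N K j) (g j) (effActionHT F N T χ K g j)) V) :
    ∀ k ≤ n, ∀ U, U ∈ D k → effActionHT F N T χ K g k (r k U) = effActionHT F N T χ K g k U := by
  intro k
  induction k with
  | zero =>
    intro _ U _
    rw [effActionHT_zero, wilsonTerm_apply, wilsonTerm_apply, h0]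
  | succ k ih =>
    intro hk V hV
    have hk' : k < n := Nat.lt_of_succ_le hk
    rw [effActionHT_succ]
    exact nextAction_eq_of_image_eq (hstep k hk' (ih hk'.le) V hV)

/-- The Wilson action is invariant under the three generators of (2.17) at level `0` (the `h0` row, discharged). [cite: Balaban1987RG1, p.263, (2.17) p.269] -/
theorem wilsonAction_invariant_generators {K : ℕ} (w : ℝ) :
    (∀ (a : Site (F.P K) 0) (U : GaugeField (F.P K) 0 (SU N)), wilsonAction w (U.translate a) = wilsonAction w U) ∧
    (∀ (π : Equiv.Perm (Fin (F.P K).d)) (U : GaugeField (F.P K) 0 (SU N)), wilsonAction w (U.permute π) = wilsonAction w U) ∧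
    (∀ (ρ : Fin (F.P K).d) (U : GaugeField (F.P K) 0 (SU N)), wilsonAction w (U.creflect ρ) = wilsonAction w U) :=
  ⟨fun a U => GaugeField.wilsonAction_translate w a U, fun π U => GaugeField.wilsonAction_permute w π U,
   fun ρ U => B12EuclClause263.wilsonAction_creflect w ρ U⟩

/-! ## §3. The per-step image row at the transport of record `T := TcanOfRecord` -/

variable {F N}

/-- **THE IMAGE ROW AT `TcanOfRecord`, generic pair**: if the level-`j` density `ρ` is invariant under the fine map AT EVERY POINT (§1), integrable, `j < K`, and
FILE E3's covariance `Tcan (ρ ∘ Φf) V = Tcan ρ (Φc V)` holds on `regSet (ρ ∘ Φf)`, then `Tcan ρ (Φc V) = Tcan ρ V` at every `V` of the maximal regular set of `ρ`.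
[cite: Balaban1987RG1, (0.13) p.254, p.263, (2.17) p.269] -/
theorem image_row_Tcan_of_comp_eq {K j : ℕ} {ρ : Density (F.P K) j (SU N)} {Φf : GaugeField (F.P K) j (SU N) → GaugeField (F.P K) j (SU N)}
    {Φc : GaugeField (F.P K) (j + 1) (SU N) → GaugeField (F.P K) (j + 1) (SU N)} (hρ : ∀ U, ρ (Φf U) = ρ U)
    (hcov : ∀ V : PBond (F.P K) (j + 1) → SU N, V ∈ regSetOfRecord F N K j (fun U => ρ (Φf U)) →
      TcanOfRecord F N K j (fun U => ρ (Φf U)) V = TcanOfRecord F N K j ρ (Φc V))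
    (V : GaugeField (F.P K) (j + 1) (SU N)) (hV : V ∈ regSetOfRecord F N K j ρ) :
    TcanOfRecord F N K j ρ (Φc V) = TcanOfRecord F N K j ρ V := by
  have hfun : (fun U => ρ (Φf U)) = ρ := funext hρ
  have h := hcov V (by rw [hfun]; exact hV)
  rw [hfun] at h
  exact h.symm

/-- **THE IMAGE ROW AT `TcanOfRecord`, translations**: `Tcan ρ (τ_a V) = Tcan ρ V` for `V ∈ regSetOfRecord K j ρ`, `ρ` integrable and `τ_{La}`-invariant at every point.
[cite: Balaban1987RG1, (0.13) p.254, p.263, (2.17) p.269] -/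
theorem image_row_Tcan_translate {K j : ℕ} (hj : j < K) {ρ : Density (F.P K) j (SU N)} (hρi : Integrable ρ (fieldMeasure (F.P K) j (SU N)))
    (a : Site (F.P K) (j + 1)) (hρ : ∀ U, ρ (U.translate (Site.scale a)) = ρ U)
    (V : GaugeField (F.P K) (j + 1) (SU N)) (hV : V ∈ regSetOfRecord F N K j ρ) :
    TcanOfRecord F N K j ρ (V.translate a) = TcanOfRecord F N K j ρ V :=
  image_row_Tcan_of_comp_eq (Φc := GaugeField.translate a) hρ (fun _ hV => TcanOfRecord_translate_of_mem_regSet hj hρi a hV) V hV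

/-- **THE IMAGE ROW AT `TcanOfRecord`, coordinate permutations.** [cite: Balaban1987RG1, (0.13) p.254, p.263, (2.17) p.269] -/
theorem image_row_Tcan_permute {K j : ℕ} (hj : j < K) {ρ : Density (F.P K) j (SU N)} (hρi : Integrable ρ (fieldMeasure (F.P K) j (SU N)))
    (π : Equiv.Perm (Fin (F.P K).d)) (hρ : ∀ U, ρ (U.permute π) = ρ U)
    (V : GaugeField (F.P K) (j + 1) (SU N)) (hV : V ∈ regSetOfRecord F N K j ρ) :
    TcanOfRecord F N K j ρ (V.permute π) = TcanOfRecord F N K j ρ V :=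
  image_row_Tcan_of_comp_eq (Φc := GaugeField.permute π) hρ (fun _ hV => TcanOfRecord_permute_of_mem_regSet hj hρi π hV) V hV

/-- **THE IMAGE ROW AT `TcanOfRecord`, centre reflections.** [cite: Balaban1987RG1, (0.13) p.254, p.263, (2.17)–(2.18) p.269] -/
theorem image_row_Tcan_creflect {K j : ℕ} (hj : j < K) {ρ : Density (F.P K) j (SU N)} (hρi : Integrable ρ (fieldMeasure (F.P K) j (SU N)))
    (r : Fin (F.P K).d) (hρ : ∀ U, ρ (U.creflect r) = ρ U)
    (V : GaugeField (F.P K) (j + 1) (SU N)) (hV : V ∈ regSetOfRecord F N K j ρ) :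
    TcanOfRecord F N K j ρ (V.creflect r) = TcanOfRecord F N K j ρ V :=
  image_row_Tcan_of_comp_eq (Φc := GaugeField.creflect r) hρ (fun _ hV => TcanOfRecord_creflect_of_mem_regSet hj hρi r hV) V hV

/-- **THE TRANSLATION STEP ROW, ASSEMBLED at `TcanOfRecord`**: the `hstep` clause of §2 for `r (j+1) := τ_a`, `r j := τ_{La}`, from the displayed per-step rows —
`D j` `τ_{La}`-stable, `χ_j` vanishing off `D j` and invariant on it, `GF_j` invariant on it, `ρ_j` integrable, `j < K`, and `D (j+1) ⊆ regSetOfRecord K j ρ_j` ((F7a) shape).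
[cite: Balaban1987RG1, p.263, (0.19) p.255, (0.13) p.254, (2.17) p.269] -/
theorem step_row_Tcan_translate (χ : (K : ℕ) → (ℕ → ℝ) → (k : ℕ) → Density (F.P K) k (SU N)) {K : ℕ} (g : ℕ → ℝ) {j : ℕ} (hj : j < K)
    (a : Site (F.P K) (j + 1)) {Dj : Set (GaugeField (F.P K) j (SU N))} {Dj' : Set (GaugeField (F.P K) (j + 1) (SU N))}
    (hDst : ∀ U, U.translate (Site.scale a) ∈ Dj ↔ U ∈ Dj) (hχD : ∀ U, U ∉ Dj → χ K g j U = 0)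
    (hχ : ∀ U, U ∈ Dj → χ K g j (U.translate (Site.scale a)) = χ K g j U)
    (hGF : ∀ U, U ∈ Dj → gfOfRecord F N K j (U.translate (Site.scale a)) = gfOfRecord F N K j U)
    (hint : Integrable (integrand (χ K g j) (gfOfRecord F N K j) (g j) (effActionHT F N (TcanOfRecord F N) χ K g j)) (fieldMeasure (F.P K) j (SU N)))
    (hreg : Dj' ⊆ regSetOfRecord F N K j (integrand (χ K g j) (gfOfRecord F N K j) (g j) (effActionHT F N (TcanOfRecord F N) χ K g j))) :
    (∀ U, U ∈ Dj → effActionHT F N (TcanOfRecord F N) χ K g j (U.translate (Site.scale a)) = effActionHT F N (TcanOfRecord F N) χ K g j U) →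
      ∀ V, V ∈ Dj' →
        TcanOfRecord F N K j (integrand (χ K g j) (gfOfRecord F N K j) (g j) (effActionHT F N (TcanOfRecord F N) χ K g j)) (V.translate a) =
          TcanOfRecord F N K j (integrand (χ K g j) (gfOfRecord F N K j) (g j) (effActionHT F N (TcanOfRecord F N) χ K g j)) V :=
  fun hA V hV => image_row_Tcan_translate hj hint a
    (integrand_comp_eq_of_invOn (r := GaugeField.translate (Site.scale a)) hDst hχD hχ hGF hA (g j)) V (hreg hV)

/-! ## §4. (v2) The π and c_ρ step rows, and the assembled translation induction at `TcanOfRecord` -/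

/-- **THE PERMUTATION STEP ROW, ASSEMBLED at `TcanOfRecord`** (the `gfOfRecord` row is displayed: by `B12GaugeFixInvariance269.gaugeFixFn_permute_of_adm` it holds on
the Federbush-admissible configurations). [cite: Balaban1987RG1, p.263, (0.19) p.255, (0.13) p.254, (2.17) p.269] -/
theorem step_row_Tcan_permute (χ : (K : ℕ) → (ℕ → ℝ) → (k : ℕ) → Density (F.P K) k (SU N)) {K : ℕ} (g : ℕ → ℝ) {j : ℕ} (hj : j < K)
    (π : Equiv.Perm (Fin (F.P K).d)) {Dj : Set (GaugeField (F.P K) j (SU N))} {Dj' : Set (GaugeField (F.P K) (j + 1) (SU N))}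
    (hDst : ∀ U, U.permute π ∈ Dj ↔ U ∈ Dj) (hχD : ∀ U, U ∉ Dj → χ K g j U = 0)
    (hχ : ∀ U, U ∈ Dj → χ K g j (U.permute π) = χ K g j U)
    (hGF : ∀ U, U ∈ Dj → gfOfRecord F N K j (U.permute π) = gfOfRecord F N K j U)
    (hint : Integrable (integrand (χ K g j) (gfOfRecord F N K j) (g j) (effActionHT F N (TcanOfRecord F N) χ K g j)) (fieldMeasure (F.P K) j (SU N)))
    (hreg : Dj' ⊆ regSetOfRecord F N K j (integrand (χ K g j) (gfOfRecord F N K j) (g j) (effActionHT F N (TcanOfRecord F N) χ K g j))) :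
    (∀ U, U ∈ Dj → effActionHT F N (TcanOfRecord F N) χ K g j (U.permute π) = effActionHT F N (TcanOfRecord F N) χ K g j U) →
      ∀ V, V ∈ Dj' →
        TcanOfRecord F N K j (integrand (χ K g j) (gfOfRecord F N K j) (g j) (effActionHT F N (TcanOfRecord F N) χ K g j)) (V.permute π) =
          TcanOfRecord F N K j (integrand (χ K g j) (gfOfRecord F N K j) (g j) (effActionHT F N (TcanOfRecord F N) χ K g j)) V :=
  fun hA V hV => image_row_Tcan_permute hj hint π
    (integrand_comp_eq_of_invOn (r := GaugeField.permute π) hDst hχD hχ hGF hA (g j)) V (hreg hV)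

/-- **THE CENTRE-REFLECTION STEP ROW, ASSEMBLED at `TcanOfRecord`** (`gfOfRecord` row: `B12GaugeFixInvariance269.gaugeFixFn_creflect`, unconditional).
[cite: Balaban1987RG1, p.263, (0.19) p.255, (0.13) p.254, (2.17)–(2.18) p.269] -/
theorem step_row_Tcan_creflect (χ : (K : ℕ) → (ℕ → ℝ) → (k : ℕ) → Density (F.P K) k (SU N)) {K : ℕ} (g : ℕ → ℝ) {j : ℕ} (hj : j < K)
    (r : Fin (F.P K).d) {Dj : Set (GaugeField (F.P K) j (SU N))} {Dj' : Set (GaugeField (F.P K) (j + 1) (SU N))}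
    (hDst : ∀ U, U.creflect r ∈ Dj ↔ U ∈ Dj) (hχD : ∀ U, U ∉ Dj → χ K g j U = 0)
    (hχ : ∀ U, U ∈ Dj → χ K g j (U.creflect r) = χ K g j U)
    (hGF : ∀ U, U ∈ Dj → gfOfRecord F N K j (U.creflect r) = gfOfRecord F N K j U)
    (hint : Integrable (integrand (χ K g j) (gfOfRecord F N K j) (g j) (effActionHT F N (TcanOfRecord F N) χ K g j)) (fieldMeasure (F.P K) j (SU N)))
    (hreg : Dj' ⊆ regSetOfRecord F N K j (integrand (χ K g j) (gfOfRecord F N K j) (g j) (effActionHT F N (TcanOfRecord F N) χ K g j))) :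
    (∀ U, U ∈ Dj → effActionHT F N (TcanOfRecord F N) χ K g j (U.creflect r) = effActionHT F N (TcanOfRecord F N) χ K g j U) →
      ∀ V, V ∈ Dj' →
        TcanOfRecord F N K j (integrand (χ K g j) (gfOfRecord F N K j) (g j) (effActionHT F N (TcanOfRecord F N) χ K g j)) (V.creflect r) =
          TcanOfRecord F N K j (integrand (χ K g j) (gfOfRecord F N K j) (g j) (effActionHT F N (TcanOfRecord F N) χ K g j)) V :=
  fun hA V hV => image_row_Tcan_creflect hj hint r
    (integrand_comp_eq_of_invOn (r := GaugeField.creflect r) hDst hχD hχ hGF hA (g j)) V (hreg hV)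

variable (F N)

/-- **`A_k(c_ρ U) = A_k(U)` ON THE DOMAINS, ALL `k ≤ n`, at `T := TcanOfRecord`** — the centre-reflection third of p. 263's clause ASSEMBLED from the displayed per-step rows
(the reflection is the same map at every level). [cite: Balaban1987RG1, p.263, (0.17)–(0.19) p.255, (2.17)–(2.18) p.269] -/
theorem invOn_effActionHT_creflect_Tcan (χ : (K : ℕ) → (ℕ → ℝ) → (k : ℕ) → Density (F.P K) k (SU N)) {K : ℕ} (g : ℕ → ℝ) {n : ℕ} (hn : n ≤ K)
    (ρ : Fin (F.P K).d) (D : (j : ℕ) → Set (GaugeField (F.P K) j (SU N)))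
    (hDst : ∀ j < n, ∀ U : GaugeField (F.P K) j (SU N), U.creflect ρ ∈ D j ↔ U ∈ D j)
    (hχD : ∀ j < n, ∀ U, U ∉ D j → χ K g j U = 0) (hχ : ∀ j < n, ∀ U, U ∈ D j → χ K g j (U.creflect ρ) = χ K g j U)
    (hGF : ∀ j < n, ∀ U, U ∈ D j → gfOfRecord F N K j (U.creflect ρ) = gfOfRecord F N K j U)
    (hint : ∀ j < n, Integrable (integrand (χ K g j) (gfOfRecord F N K j) (g j) (effActionHT F N (TcanOfRecord F N) χ K g j)) (fieldMeasure (F.P K) j (SU N)))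
    (hreg : ∀ j < n, D (j + 1) ⊆ regSetOfRecord F N K j (integrand (χ K g j) (gfOfRecord F N K j) (g j) (effActionHT F N (TcanOfRecord F N) χ K g j))) :
    ∀ k ≤ n, ∀ U, U ∈ D k → effActionHT F N (TcanOfRecord F N) χ K g k (U.creflect ρ) = effActionHT F N (TcanOfRecord F N) χ K g k U :=
  invOn_effActionHT_of_stepsOn_family F N (TcanOfRecord F N) χ K g n D (fun _ U => U.creflect ρ)
    (fun U => (wilsonAction_invariant_generators F N (K := K) 1).2.2 ρ U)
    (fun j hj ih => step_row_Tcan_creflect χ g (lt_of_lt_of_le hj hn) ρ (hDst j hj) (hχD j hj) (hχ j hj) (hGF j hj) (hint j hj) (hreg j hj) ih)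

/-- **`A_k(π U) = A_k(U)` ON THE DOMAINS, ALL `k ≤ n`, at `T := TcanOfRecord`** — the permutation third, assembled. [cite: Balaban1987RG1, p.263, (0.17)–(0.19) p.255, (2.17) p.269] -/
theorem invOn_effActionHT_permute_Tcan (χ : (K : ℕ) → (ℕ → ℝ) → (k : ℕ) → Density (F.P K) k (SU N)) {K : ℕ} (g : ℕ → ℝ) {n : ℕ} (hn : n ≤ K)
    (π : Equiv.Perm (Fin (F.P K).d)) (D : (j : ℕ) → Set (GaugeField (F.P K) j (SU N)))
    (hDst : ∀ j < n, ∀ U : GaugeField (F.P K) j (SU N), U.permute π ∈ D j ↔ U ∈ D j)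
    (hχD : ∀ j < n, ∀ U, U ∉ D j → χ K g j U = 0) (hχ : ∀ j < n, ∀ U, U ∈ D j → χ K g j (U.permute π) = χ K g j U)
    (hGF : ∀ j < n, ∀ U, U ∈ D j → gfOfRecord F N K j (U.permute π) = gfOfRecord F N K j U)
    (hint : ∀ j < n, Integrable (integrand (χ K g j) (gfOfRecord F N K j) (g j) (effActionHT F N (TcanOfRecord F N) χ K g j)) (fieldMeasure (F.P K) j (SU N)))
    (hreg : ∀ j < n, D (j + 1) ⊆ regSetOfRecord F N K j (integrand (χ K g j) (gfOfRecord F N K j) (g j) (effActionHT F N (TcanOfRecord F N) χ K g j))) :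
    ∀ k ≤ n, ∀ U, U ∈ D k → effActionHT F N (TcanOfRecord F N) χ K g k (U.permute π) = effActionHT F N (TcanOfRecord F N) χ K g k U :=
  invOn_effActionHT_of_stepsOn_family F N (TcanOfRecord F N) χ K g n D (fun _ U => U.permute π)
    (fun U => (wilsonAction_invariant_generators F N (K := K) 1).2.1 π U)
    (fun j hj ih => step_row_Tcan_permute χ g (lt_of_lt_of_le hj hn) π (hDst j hj) (hχD j hj) (hχ j hj) (hGF j hj) (hint j hj) (hreg j hj) ih)

/-- **`A_k(τ U) = A_k(U)` ON THE DOMAINS, ALL `k ≤ n`, at `T := TcanOfRecord`** — the translation third, assembled; the translation vector at level `j` is `b j` with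
`b j = L · b (j+1)` (`Site.scale`: one coarse lattice symmetry read at every level). [cite: Balaban1987RG1, p.263, (0.17)–(0.19) p.255, (2.17) p.269] -/
theorem invOn_effActionHT_translate_Tcan (χ : (K : ℕ) → (ℕ → ℝ) → (k : ℕ) → Density (F.P K) k (SU N)) {K : ℕ} (g : ℕ → ℝ) {n : ℕ} (hn : n ≤ K)
    (b : (j : ℕ) → Site (F.P K) j) (hb : ∀ j, b j = Site.scale (b (j + 1))) (D : (j : ℕ) → Set (GaugeField (F.P K) j (SU N)))
    (hDst : ∀ j < n, ∀ U : GaugeField (F.P K) j (SU N), U.translate (b j) ∈ D j ↔ U ∈ D j)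
    (hχD : ∀ j < n, ∀ U, U ∉ D j → χ K g j U = 0) (hχ : ∀ j < n, ∀ U, U ∈ D j → χ K g j (U.translate (b j)) = χ K g j U)
    (hGF : ∀ j < n, ∀ U, U ∈ D j → gfOfRecord F N K j (U.translate (b j)) = gfOfRecord F N K j U)
    (hint : ∀ j < n, Integrable (integrand (χ K g j) (gfOfRecord F N K j) (g j) (effActionHT F N (TcanOfRecord F N) χ K g j)) (fieldMeasure (F.P K) j (SU N)))
    (hreg : ∀ j < n, D (j + 1) ⊆ regSetOfRecord F N K j (integrand (χ K g j) (gfOfRecord F N K j) (g j) (effActionHT F N (TcanOfRecord F N) χ K g j))) :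
    ∀ k ≤ n, ∀ U, U ∈ D k → effActionHT F N (TcanOfRecord F N) χ K g k (U.translate (b k)) = effActionHT F N (TcanOfRecord F N) χ K g k U := by
  refine invOn_effActionHT_of_stepsOn_family F N (TcanOfRecord F N) χ K g n D (fun j U => U.translate (b j))
    (fun U => (wilsonAction_invariant_generators F N (K := K) 1).1 (b 0) U) (fun j hj ih => ?_)
  have hDst' := hDst j hj
  have hχ' := hχ j hj
  have hGF' := hGF j hj
  rw [hb j] at hDst' hχ' hGF' ih
  exact step_row_Tcan_translate χ g (lt_of_lt_of_le hj hn) (b (j + 1)) hDst' (hχD j hj) hχ' hGF' (hint j hj) (hreg j hj) ih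

end Summit.QuantumFields.YangMills.Theorems.BalabanUVNodesPortS1

end
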